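import Summits.Ventures.YMGap.RobustBall.KernelVarianceSum
import Summits.Ventures.YMGap.RobustBall.PlaquetteVarianceFloor
import Summits.Ventures.YMGap.RobustBall.PerturbedCollar
import Summits.Ventures.YMGap.Thresholds.OneLinkTiltStability
import HarnessLib

/-!
# Venture YMGap, track ROBUST-BALL — VARIANCE OF A PLAQUETTE SUM ≥ THE SPARSE-LINK CONDITIONAL VARIANCES
# (lattice Yang–Mills on `ℤ^d`, every compact group, every DLR state, every coupling)

HONEST FRAMING. WHAT THIS IS: a venture file (cell `pub-ymgap`, track Y2 ROBUST-BALL, seat ds-3, theorems only; step 3 of the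
non-degeneracy «C-CLT-ND» of the plaquette central limit theorem). For the Wilson specification `γ = ymSpecification ρ β` of a
continuous `N`-dimensional representation `ρ` of a compact group (`|Re tr ρ| ≤ N`), a finite family `Q` of plaquettes with sum
`S_Q = Σ_{q∈Q} W_q`, and a finite family `E` of links which is PLAQUETTE-SPARSE (no plaquette of `ℤ^d` contains two distinct links
of `E`):
* ★★ `sum_integral_condVariance_le_variance` — for EVERY DLR state `μ`:
  `Σ_{e∈E} ∫ Var_{γ_{e}(·|σ)}(g_e) dμ(σ) ≤ Var_μ(S_Q)`, `g_e = Σ_{q∈Q, e∈q} W_q` the plaquettes of `Q` through `e`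
  (the abstract engine `KernelVariance.sum_integral_floor_le_variance`; its hypotheses (P) "the other kernels do not move `g_e`" and
  (C) "`γ_{E'}(S_Q − g_e)` is blind to the link `e`" are discharged by sparsity through properness and the quasilocality of the
  Wilson kernels, `dependsOn_specAvg_perturbedYM` at `W = 0`);
* `condVariance_ge_exp_neg_mul_fibreVariance` — the one-link kernel is glued Haar measure tilted by an energy of OSCILLATION
  `≤ |β|·2N·#(plaquettes ∋ e)` (sharp form, no factor 2), so `Var_{γ_e(·|σ)}(X) ≥ e^{−|β|·2N·#(plaquettes ∋ e)} · Var_{Haar fibre at σ}(X)`;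
* `abs_condMean_sub_fibreMean_le` — Grüss: `|γ_e X(σ) − (Haar fibre mean of X at σ)| ≤ osc(X) · |β|·2N·#(plaquettes ∋ e) / 4`;
* `integral_fibre_eq_haar`, `plaquetteObs_glueWith_singleton_first`, `plaquetteObs_below_glueWith_singleton` — transport of one-link
  fibre integrals to Haar integrals, and the two plaquettes of a given orientation through a link, on the fibre of that link (in the
  plaquette below the link it enters inverted).
WHAT THIS IS NOT: no group-specific Haar computation (the `SU(2)` two-staple variance `2 + W_{1×2}` and `χ(W_p) > 0` are the next
file); lattice statements only.
References: H.-O. Georgii, Gibbs Measures and Phase Transitions (2011) §1.2–1.3 (properness, DLR); G. Grüss, Math. Z. 39 (1935).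
-/

noncomputable section

open MeasureTheory ProbabilityTheory Real Finset
open Literature.Probability.LatticeModels hiding configShift configShift_apply
open Literature.MathematicalPhysics.QuantumFieldTheory hiding ZdEdge Site
open Literature.MathematicalPhysics.QuantumLattice
open Literature.MathematicalPhysics.QuantumFieldTheory.Balaban1983to89.StrongCouplingTorusWindow (specAvg)
open Summit.Ventures.YMGap.RobustBall.LoopScreening

namespace Summit.Ventures.YMGap.RobustBall

namespace PlaquetteSum

variable {d : ℕ} {G : Type*} [Group G] [TopologicalSpace G] [IsTopologicalGroup G] [CompactSpace G] [T2Space G]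
  [MeasurableSpace G] [BorelSpace G] [SecondCountableTopology G] {N : ℕ} {ρ : G →* Matrix (Fin N) (Fin N) ℂ}

/-! ### Plaquette sums: measurability, bounds, locality -/

omit [T2Space G] [CompactSpace G] in
/-- A finite sum of plaquette observables is measurable. [folklore] -/
theorem measurable_plaquetteSum (hρ : Continuous ρ) (Q : Finset (ZdPlaquette d)) :
    Measurable fun U : LGConfig d G => ∑ q ∈ Q, plaquetteObs ρ q.1 q.2.1.1 q.2.1.2 U :=
  Finset.measurable_sum _ fun q _ => (continuous_plaquetteObs ρ hρ q.1 q.2.1.1 q.2.1.2).measurable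

omit [TopologicalSpace G] [IsTopologicalGroup G] [CompactSpace G] [T2Space G] [MeasurableSpace G] [BorelSpace G]
  [SecondCountableTopology G] in
/-- `|Σ_{q∈Q} W_q| ≤ #Q · N` when `|Re tr ρ| ≤ N`. [folklore] -/
theorem abs_plaquetteSum_le (hM : ∀ g, |(ρ g).trace.re| ≤ N) (Q : Finset (ZdPlaquette d)) (U : LGConfig d G) :
    |∑ q ∈ Q, plaquetteObs ρ q.1 q.2.1.1 q.2.1.2 U| ≤ Q.card * N := by
  refine (Finset.abs_sum_le_sum_abs _ _).trans ?_
  have : (Q.card : ℝ) * N = ∑ _q ∈ Q, (N : ℝ) := by rw [Finset.sum_const, nsmul_eq_mul]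
  rw [this]
  exact Finset.sum_le_sum fun q _ => hM _

omit [TopologicalSpace G] [IsTopologicalGroup G] [CompactSpace G] [T2Space G] [MeasurableSpace G] [BorelSpace G]
  [SecondCountableTopology G] in
/-- A plaquette sum depends only on the links of its plaquettes. [folklore] -/
theorem dependsOn_plaquetteSum (Q : Finset (ZdPlaquette d)) :
    DependsOn (fun U : LGConfig d G => ∑ q ∈ Q, plaquetteObs ρ q.1 q.2.1.1 q.2.1.2 U)
      (↑(Q.biUnion plaquetteEdges) : Set (ZdEdge d)) :=
  fun _ _ h => Finset.sum_congr rfl fun q hq =>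
    isCylinder_plaquetteObs ρ q fun e he => h e (Finset.mem_coe.2 (Finset.mem_biUnion.2 ⟨q, hq, he⟩))

/-- **Properness, integral form**: an observable blind to the spins in `Λ` is reproduced by the kernel `γ_Λ`. [folklore] -/
theorem kernel_integral_eq_self_of_dependsOn_compl {V S : Type*} [MeasurableSpace S] {γ : Specification V S}
    (hγ : IsSpecification γ) (Λ : Finset V) {F : (V → S) → ℝ} (hF : DependsOn F ((↑Λ : Set V)ᶜ)) (η : V → S) :
    ∫ σ, F σ ∂(γ Λ η) = F η := by
  haveI := hγ.isProbability Λ η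
  have h : (fun σ => F σ) =ᵐ[γ Λ η] fun _ => F η := by
    filter_upwards [hγ.proper Λ η] with σ hσ
    exact hF fun i hi => hσ i fun h => hi (Finset.mem_coe.2 h)
  rw [integral_congr_ae h, integral_const, smul_eq_mul, probReal_univ, one_mul]

/-! ### ★★ The sparse-link bound for plaquette sums -/

/-- ★★ **VARIANCE OF A PLAQUETTE SUM ≥ THE SUM OF THE SPARSE-LINK CONDITIONAL VARIANCES.** For the Wilson specification of a
continuous representation `ρ` (`|Re tr ρ| ≤ N`) at any coupling `β`, any DLR state `μ`, any finite plaquette family `Q` and any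
PLAQUETTE-SPARSE finite link family `E` (no plaquette contains two distinct links of `E`):
`Σ_{e∈E} ∫ Var_{γ_{e}(·|σ)}(g_e) dμ(σ) ≤ Var_μ(Σ_{q∈Q} W_q)`, where `g_e = Σ_{q∈Q, e ∈ q} W_q`.
Proof: `KernelVariance.sum_integral_floor_le_variance` with the one-link conditional variance as its own floor; (P) by properness
(the plaquettes through `e` avoid `E ∖ {e}` by sparsity); (C) by the quasilocality of `γ_{E'}` (`dependsOn_specAvg_perturbedYM`,
`W = 0`): `γ_{E'}(S_Q − g_e)` depends on the links of the plaquettes avoiding `e`, on `E'`, and on the plaquette-neighbours of `E'`,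
none of which is `e`. [folklore] -/
theorem sum_integral_condVariance_le_variance (hρ : Continuous ρ) (hM : ∀ g, |(ρ g).trace.re| ≤ N) (β : ℝ)
    {μ : Measure (LGConfig d G)} (hμ : μ ∈ ymGibbsMeasures (d := d) ρ β) (Q : Finset (ZdPlaquette d))
    {E : Finset (ZdEdge d)}
    (hE : ∀ e ∈ E, ∀ e' ∈ E, e ≠ e' → ∀ p : ZdPlaquette d, e ∈ plaquetteEdges p → e' ∉ plaquetteEdges p) :
    ∑ e ∈ E, ∫ σ, (∫ τ, ((∑ q ∈ Q.filter (fun q => e ∈ plaquetteEdges q), plaquetteObs ρ q.1 q.2.1.1 q.2.1.2 τ) -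
        ∫ τ', (∑ q ∈ Q.filter (fun q => e ∈ plaquetteEdges q), plaquetteObs ρ q.1 q.2.1.1 q.2.1.2 τ')
          ∂(ymSpecification (d := d) ρ β {e} σ)) ^ 2 ∂(ymSpecification (d := d) ρ β {e} σ)) ∂μ ≤
      ∫ U, ((∑ q ∈ Q, plaquetteObs ρ q.1 q.2.1.1 q.2.1.2 U) - ∫ U', (∑ q ∈ Q, plaquetteObs ρ q.1 q.2.1.1 q.2.1.2 U') ∂μ) ^ 2 ∂μ := by
  classical
  have hγ : IsSpecification (ymSpecification (d := d) ρ β) := isSpecification_ymSpecification_of_t2Space (d := d) ρ hρ β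
  have hGibbs : IsGibbsMeasure (ymSpecification (d := d) ρ β) μ := hμ
  -- data for the abstract engine
  have hgm : ∀ e : ZdEdge d, Measurable fun τ : LGConfig d G =>
      ∑ q ∈ Q.filter (fun q => e ∈ plaquetteEdges q), plaquetteObs ρ q.1 q.2.1.1 q.2.1.2 τ :=
    fun e => measurable_plaquetteSum hρ _
  have hgb : ∀ (e : ZdEdge d) (τ : LGConfig d G),
      |∑ q ∈ Q.filter (fun q => e ∈ plaquetteEdges q), plaquetteObs ρ q.1 q.2.1.1 q.2.1.2 τ| ≤ Q.card * N := fun e τ =>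
    (abs_plaquetteSum_le hM _ τ).trans (mul_le_mul_of_nonneg_right (by exact_mod_cast Finset.card_filter_le _ _) (Nat.cast_nonneg _))
  have hvar := fun e : ZdEdge d => KernelVariance.measurable_variance_kernel hγ {e} (hgm e) (hgb e)
  refine KernelVariance.sum_integral_floor_le_variance hγ hGibbs (measurable_plaquetteSum hρ Q) (abs_plaquetteSum_le hM Q) hgm hgb
    (f := fun e σ => ∫ τ, ((∑ q ∈ Q.filter (fun q => e ∈ plaquetteEdges q), plaquetteObs ρ q.1 q.2.1.1 q.2.1.2 τ) -
        ∫ τ', (∑ q ∈ Q.filter (fun q => e ∈ plaquetteEdges q), plaquetteObs ρ q.1 q.2.1.1 q.2.1.2 τ')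
          ∂(ymSpecification (d := d) ρ β {e} σ)) ^ 2 ∂(ymSpecification (d := d) ρ β {e} σ))
    (fun e => (hvar e).1) (fun e σ => (hvar e).2 σ) ?_ ?_ ?_
  · -- (F): the conditional variance is the least mean square deviation
    intro e _ σ c
    haveI := hγ.isProbability {e} σ
    exact integral_sq_sub_integral_le (hgm e) (hgb e) c
  · -- (P): properness — the plaquettes through `e` avoid `E'`
    intro e he E' hE'E heE' σ
    refine kernel_integral_eq_self_of_dependsOn_compl hγ E' ((dependsOn_plaquetteSum (ρ := ρ) _).mono fun e'' he'' => ?_) σ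
    intro hmem
    have he''E' : e'' ∈ E' := Finset.mem_coe.1 hmem
    obtain ⟨q, hq, he''q⟩ := Finset.mem_biUnion.1 (Finset.mem_coe.1 he'')
    have heq : e ∈ plaquetteEdges q := (Finset.mem_filter.1 hq).2
    have hne : e ≠ e'' := fun h => heE' (h ▸ he''E')
    exact hE e he e'' (hE'E he''E') hne q heq he''q
  · -- (C): quasilocality of `γ_{E'}` — the remainder and the collar of `E'` avoid `e`
    intro e he E' hE'E heE' σ τ hτσ
    have hsplit : ∀ ω : LGConfig d G, (∑ q ∈ Q, plaquetteObs ρ q.1 q.2.1.1 q.2.1.2 ω) -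
        (∑ q ∈ Q.filter (fun q => e ∈ plaquetteEdges q), plaquetteObs ρ q.1 q.2.1.1 q.2.1.2 ω) =
        ∑ q ∈ Q.filter (fun q => e ∉ plaquetteEdges q), plaquetteObs ρ q.1 q.2.1.1 q.2.1.2 ω := fun ω => by
      rw [← Finset.sum_filter_add_sum_filter_not Q (fun q => e ∈ plaquetteEdges q)]; ring
    simp_rw [hsplit]
    have hsupp : (0 : Potential (ZdEdge d) G).IsSupportedBy (fun _ => (∅ : Finset (Finset (ZdEdge d)))) :=
      fun _ _ _ h => (h rfl).elim
    have hdep := dependsOn_specAvg_perturbedYM (d := d) ρ hρ β (W := 0) (fun _ => measurable_const)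
      (fun X => fun _ _ _ => rfl) hsupp E' (measurable_plaquetteSum hρ (Q.filter fun q => e ∉ plaquetteEdges q))
      (dependsOn_plaquetteSum (ρ := ρ) (Q.filter fun q => e ∉ plaquetteEdges q))
    rw [perturbedYM_zero] at hdep
    have key := @hdep τ σ fun x hx => hτσ x ?_
    · simpa only [specAvg] using key
    -- `x` in the dependence set is not `e`
    rintro rfl
    rcases Finset.mem_union.1 (Finset.mem_coe.1 hx) with h1 | h2
    · obtain ⟨q, hq, hxq⟩ := Finset.mem_biUnion.1 h1
      exact (Finset.mem_filter.1 hq).2 hxq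
    · rcases Finset.mem_union.1 h2 with h3 | h4
      · exact heE' h3
      · obtain ⟨e', he'E', hxe'⟩ := Finset.mem_biUnion.1 h4
        have hx' := Finset.mem_of_mem_erase hxe'
        have hne : x ≠ e' := Finset.ne_of_mem_erase hxe'
        rcases Finset.mem_union.1 hx' with h5 | h6
        · obtain ⟨-, p, he'p, hxp⟩ := mem_linkPlaqNbr_iff.1 h5
          exact hE e' (hE'E he'E') x he hne.symm p he'p hxp
        · simp at h6

/-! ### The one-link kernel against the glued Haar fibre -/

omit [T2Space G] in
/-- **Conditional variance ≥ `e^{−osc}` × fibre variance (sharp oscillation form).** The one-link Wilson kernel at `e` is the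
glued Haar fibre measure `ν_σ` tilted by `−β S_e`, an energy taking values in an interval of length `|β|·2N·#(plaquettes ∋ e)`;
hence for every bounded measurable `X`: `e^{−|β|·2N·#(plaquettes ∋ e)} · Var_{ν_σ}(X) ≤ Var_{γ_e(·|σ)}(X)`. [folklore] -/
theorem condVariance_ge_exp_neg_mul_fibreVariance (hρ : Continuous ρ) (hM : ∀ g, |(ρ g).trace.re| ≤ N) (β : ℝ) (e : ZdEdge d)
    (σ : LGConfig d G) {X : LGConfig d G → ℝ} (hX : Measurable X) {M : ℝ} (hXb : ∀ U, |X U| ≤ M) :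
    exp (-(|β| * (2 * N * (plaquettesTouching {e}).card))) *
        ∫ U, (X U - ∫ U', X U' ∂((Measure.pi fun _ : ↥({e} : Finset (ZdEdge d)) => haarProbability G).map (glueWith {e} · σ))) ^ 2
          ∂((Measure.pi fun _ : ↥({e} : Finset (ZdEdge d)) => haarProbability G).map (glueWith {e} · σ)) ≤
      ∫ U, (X U - ∫ U', X U' ∂(ymSpecification (d := d) ρ β {e} σ)) ^ 2 ∂(ymSpecification (d := d) ρ β {e} σ) := by
  set ν := (Measure.pi fun _ : ↥({e} : Finset (ZdEdge d)) => haarProbability G).map (glueWith {e} · σ) with hν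
  haveI : IsProbabilityMeasure ν := Measure.isProbabilityMeasure_map (measurable_glueWith _ σ).aemeasurable
  set D : ℝ := |β| * (2 * N * (plaquettesTouching {e}).card) with hD
  -- the tilt lies in an interval of length `D`
  have hφ : ∀ U : LGConfig d G, min (-β * (2 * N * (plaquettesTouching {e}).card)) 0 ≤ -β * wilsonBoundaryAction ρ {e} U ∧
      -β * wilsonBoundaryAction ρ {e} U ≤ min (-β * (2 * N * (plaquettesTouching {e}).card)) 0 + D := by
    intro U
    obtain ⟨h0, h1⟩ := PlaquetteFloor.wilsonBoundaryAction_singleton_mem hM e U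
    have hS0 : (0 : ℝ) ≤ 2 * N * (plaquettesTouching {e}).card := by positivity
    rcases le_or_gt 0 β with hb | hb
    · rw [abs_of_nonneg hb] at hD
      have hmin : min (-β * (2 * N * (plaquettesTouching {e}).card)) 0 = -β * (2 * N * (plaquettesTouching {e}).card) :=
        min_eq_left (by nlinarith)
      rw [hmin, hD]
      constructor <;> nlinarith [mul_le_mul_of_nonneg_left h1 hb, mul_nonneg hb h0]
    · rw [abs_of_neg hb] at hD
      have hmin : min (-β * (2 * N * (plaquettesTouching {e}).card)) 0 = 0 := min_eq_right (by nlinarith)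
      rw [hmin, hD]
      constructor <;> nlinarith [mul_le_mul_of_nonneg_left h1 (neg_nonneg.2 hb.le), mul_nonneg (neg_nonneg.2 hb.le) h0]
  have htilt := fun c => exp_neg_mul_integral_sq_le_integral_tilted (ν := ν) hX hXb
    ((continuous_const.mul (continuous_wilsonBoundaryAction ρ hρ _)).measurable) (Filter.Eventually.of_forall hφ) c
  have hker : ymSpecification (d := d) ρ β {e} σ = ν.tilted fun U => -β * wilsonBoundaryAction ρ {e} U := by
    unfold ymSpecification; rw [← hν]
  set m := ∫ U', X U' ∂(ymSpecification (d := d) ρ β {e} σ) with hm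
  calc exp (-D) * ∫ U, (X U - ∫ U', X U' ∂ν) ^ 2 ∂ν ≤ exp (-D) * ∫ U, (X U - m) ^ 2 ∂ν :=
        mul_le_mul_of_nonneg_left (integral_sq_sub_integral_le hX hXb m) (exp_nonneg _)
    _ ≤ ∫ U, (X U - m) ^ 2 ∂(ν.tilted fun U => -β * wilsonBoundaryAction ρ {e} U) := htilt m
    _ = _ := by rw [← hker]

omit [T2Space G] in
/-- **Conditional mean vs fibre mean (Grüss).** For a bounded measurable `X` of oscillation `≤ Ω` (`|X a − X b| ≤ Ω`):
`|γ_e X(σ) − ν_σ(X)| ≤ Ω · (|β|·2N·#(plaquettes ∋ e)) / 4`, `ν_σ` the glued Haar fibre at `σ`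
(`OneLinkTiltStability.abs_integral_tilted_sub_tilted_le_of_osc` against the zero tilt). [folklore] -/
theorem abs_condMean_sub_fibreMean_le (hρ : Continuous ρ) (hM : ∀ g, |(ρ g).trace.re| ≤ N) (β : ℝ) (e : ZdEdge d)
    (σ : LGConfig d G) {X : LGConfig d G → ℝ} (hX : Measurable X) {M Ω : ℝ} (hXb : ∀ U, |X U| ≤ M)
    (hXΩ : ∀ U V, |X U - X V| ≤ Ω) :
    |∫ U, X U ∂(ymSpecification (d := d) ρ β {e} σ) -
        ∫ U, X U ∂((Measure.pi fun _ : ↥({e} : Finset (ZdEdge d)) => haarProbability G).map (glueWith {e} · σ))| ≤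
      Ω * (|β| * (2 * N * (plaquettesTouching {e}).card)) / 4 := by
  set ν := (Measure.pi fun _ : ↥({e} : Finset (ZdEdge d)) => haarProbability G).map (glueWith {e} · σ) with hν
  haveI : IsProbabilityMeasure ν := Measure.isProbabilityMeasure_map (measurable_glueWith _ σ).aemeasurable
  have hker : ymSpecification (d := d) ρ β {e} σ = ν.tilted fun U => -β * wilsonBoundaryAction ρ {e} U := by
    unfold ymSpecification; rw [← hν]
  have hSm : Measurable fun U : LGConfig d G => -β * wilsonBoundaryAction ρ {e} U :=
    (continuous_const.mul (continuous_wilsonBoundaryAction ρ hρ _)).measurable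
  have hSb : ∃ C, ∀ U : LGConfig d G, |-β * wilsonBoundaryAction ρ {e} U| ≤ C :=
    ⟨|β| * (2 * N * (plaquettesTouching {e}).card), fun U => by
      obtain ⟨h0, h1⟩ := PlaquetteFloor.wilsonBoundaryAction_singleton_mem hM e U
      rw [abs_mul, abs_neg, abs_of_nonneg h0]
      exact mul_le_mul_of_nonneg_left h1 (abs_nonneg _)⟩
  have hW : ∀ a b : LGConfig d G, |(-β * wilsonBoundaryAction ρ {e} a - (fun _ : LGConfig d G => (0 : ℝ)) a) -
      (-β * wilsonBoundaryAction ρ {e} b - (fun _ : LGConfig d G => (0 : ℝ)) b)| ≤ |β| * (2 * N * (plaquettesTouching {e}).card) := by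
    intro a b
    obtain ⟨ha0, ha1⟩ := PlaquetteFloor.wilsonBoundaryAction_singleton_mem hM e a
    obtain ⟨hb0, hb1⟩ := PlaquetteFloor.wilsonBoundaryAction_singleton_mem hM e b
    simp only [sub_zero]
    rw [show -β * wilsonBoundaryAction ρ {e} a - -β * wilsonBoundaryAction ρ {e} b =
      β * (wilsonBoundaryAction ρ {e} b - wilsonBoundaryAction ρ {e} a) by ring, abs_mul]
    exact mul_le_mul_of_nonneg_left (abs_le.2 ⟨by linarith, by linarith⟩) (abs_nonneg _)
  have h := OneLinkTiltStability.abs_integral_tilted_sub_tilted_le_of_osc (μ := ν) (U' := fun _ => (0 : ℝ)) hSm hSb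
    measurable_const ⟨0, fun _ => by rw [abs_zero]⟩ hX ⟨M, hXb⟩ hXΩ hW
  rwa [tilted_const, ← hker] at h

/-! ### Fibre integrals are Haar integrals -/

omit [T2Space G] [SecondCountableTopology G] in
/-- **Transport of one-link fibre integrals to Haar integrals**: if on the fibre of `e₀` through `η` the observable `F` reads
`F(glue ζ η) = h(ζ_{e₀})`, then `∫ F dν_η = ∫ h dHaar`. [folklore] -/
theorem integral_fibre_eq_haar (e₀ : ZdEdge d) (η : LGConfig d G) {F : LGConfig d G → ℝ} (hF : Measurable F) {h : G → ℝ}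
    (hh : Measurable h) (hFh : ∀ ζ : ↥({e₀} : Finset (ZdEdge d)) → G, F (glueWith {e₀} ζ η) = h (ζ ⟨e₀, Finset.mem_singleton_self _⟩)) :
    ∫ U, F U ∂((Measure.pi fun _ : ↥({e₀} : Finset (ZdEdge d)) => haarProbability G).map (glueWith {e₀} · η)) =
      ∫ g, h g ∂haarProbability G := by
  rw [integral_map (measurable_glueWith _ η).aemeasurable hF.aestronglyMeasurable]
  simp_rw [hFh]
  have hev := measurePreserving_eval (fun _ : ↥({e₀} : Finset (ZdEdge d)) => haarProbability G)
    ⟨e₀, Finset.mem_singleton_self _⟩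
  have h1 := integral_map (μ := Measure.pi fun _ : ↥({e₀} : Finset (ZdEdge d)) => haarProbability G)
    hev.measurable.aemeasurable (f := h) hh.aestronglyMeasurable
  rw [hev.map_eq] at h1
  exact h1.symm

omit [TopologicalSpace G] [IsTopologicalGroup G] [CompactSpace G] [T2Space G] [MeasurableSpace G] [BorelSpace G]
  [SecondCountableTopology G] in
/-- **The plaquette BELOW a link, on the fibre of that link**: with all links but `e = (y, i)` frozen at `η` (`i ≠ j`), the plaquette
`(y − eⱼ; i, j)` — whose third link is `e`, entering inverted — reads
`W_{(y−eⱼ;i,j)}(glue ζ η) = Re tr ρ(η_{(y−eⱼ,i)} η_{(y−eⱼ+eᵢ,j)} ζ⁻¹ η_{(y−eⱼ,j)}⁻¹)`. [folklore] -/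
theorem plaquetteObs_below_glueWith_singleton {y : Site d} {i j : Fin d} (hij : i ≠ j)
    (ζ : ↥({(y, i)} : Finset (ZdEdge d)) → G) (η : LGConfig d G) :
    plaquetteObs ρ (y - Pi.single j 1) i j (glueWith {(y, i)} ζ η) =
      (ρ (η (y - Pi.single j 1, i) * η (y - Pi.single j 1 + Pi.single i 1, j) * (ζ ⟨(y, i), Finset.mem_singleton_self _⟩)⁻¹ *
        (η (y - Pi.single j 1, j))⁻¹)).trace.re := by
  have hne1 : ((y - Pi.single j 1, i) : ZdEdge d) ≠ (y, i) := fun h => by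
    have h1 := congr_fun (Prod.mk.inj h).1 j
    simp at h1
  have hne2 : ((y - Pi.single j 1 + Pi.single i 1, j) : ZdEdge d) ≠ (y, i) := fun h => hij (Prod.mk.inj h).2.symm
  have heq : ((y - Pi.single j 1 + Pi.single j 1, i) : ZdEdge d) = (y, i) := by rw [sub_add_cancel]
  have hne3 : ((y - Pi.single j 1, j) : ZdEdge d) ≠ (y, i) := fun h => hij (Prod.mk.inj h).2.symm
  rw [plaquetteObs, plaquetteHolonomyZd, PlaquetteFloor.glueWith_singleton_apply, PlaquetteFloor.glueWith_singleton_apply,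
    PlaquetteFloor.glueWith_singleton_apply, PlaquetteFloor.glueWith_singleton_apply, if_neg hne1, if_neg hne2, heq, if_pos rfl,
    if_neg hne3]

omit [TopologicalSpace G] [IsTopologicalGroup G] [CompactSpace G] [T2Space G] [MeasurableSpace G] [BorelSpace G]
  [SecondCountableTopology G] in
/-- **The plaquette on the fibre of its first link, trace form**: with all links but `e = (x, i)` frozen at `η` (`i ≠ j`),
`W_{(x;i,j)}(glue ζ η) = Re tr ρ(ζ η_{(x+eᵢ,j)} η_{(x+eⱼ,i)}⁻¹ η_{(x,j)}⁻¹)`. [folklore] -/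
theorem plaquetteObs_glueWith_singleton_first {x : Site d} {i j : Fin d} (hij : i ≠ j)
    (ζ : ↥({(x, i)} : Finset (ZdEdge d)) → G) (η : LGConfig d G) :
    plaquetteObs ρ x i j (glueWith {(x, i)} ζ η) =
      (ρ (ζ ⟨(x, i), Finset.mem_singleton_self _⟩ * η (x + Pi.single i 1, j) * (η (x + Pi.single j 1, i))⁻¹ * (η (x, j))⁻¹)).trace.re := by
  have hne1 : ((x + Pi.single i 1, j) : ZdEdge d) ≠ (x, i) := fun h => hij (Prod.mk.inj h).2.symm
  have hne2 : ((x + Pi.single j 1, i) : ZdEdge d) ≠ (x, i) := fun h => by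
    have h1 := congr_fun (Prod.mk.inj h).1 j
    simp at h1
  have hne3 : ((x, j) : ZdEdge d) ≠ (x, i) := fun h => hij (Prod.mk.inj h).2.symm
  rw [plaquetteObs, plaquetteHolonomyZd, PlaquetteFloor.glueWith_singleton_apply, PlaquetteFloor.glueWith_singleton_apply,
    PlaquetteFloor.glueWith_singleton_apply, PlaquetteFloor.glueWith_singleton_apply, if_pos rfl, if_neg hne1, if_neg hne2, if_neg hne3]

end PlaquetteSum

end Summit.Ventures.YMGap.RobustBall

end
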